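import Summits.PneNP.PneNP.Theses.RootDecompMcspReach
import Summits.PneNP.PneNP.Theorems.RootDecompMcspReachReachMachinery

/-!
# `RootDecompMcspReach.ParityReachGivesMCSPNotAC0` (stmt-PneNP-32191) — the payout edge of the notch

Node N41 (route `route-PneNP-RootDecompMcspReach`, lens-3 g9): if PARITY reduces to exact MCSP under
non-uniform constant-depth `acBasis`-reductions (the notch `ParityReach`, inlined in the item), then
`MCSP ∉ AC⁰` — by the closure of `AC⁰` under such reductions (ported closure law
`RootDecompMcspReachPort.mem_cdp_of_cdRed`) and `PARITY ∉ AC⁰` (from `AC⁰ ⊆ AC⁰[3]` and the tree's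
discharged Smolensky theorem `Smolensky1987_modq_not_mem_AC0Mod_holds.parity_not_mem`, as in the lens).  Port of the lens kernel
`mcsp_not_mem_AC0_of_parityReach` (writer pack `parityReachGivesMCSPNotAC0_holds`).  0 sorry.
[cite: Smolensky1987]
-/

namespace Summit.PneNP.PneNP.Theorems

open Literature.Computability.Complexity Literature.Computability.MetaComplexity

/-- The payout edge (stmt-PneNP-32191, `ParityReachGivesMCSPNotAC0`): `ParityReach → MCSP ∉ AC⁰`.
Port of the lens-3 g9 kernel `mcsp_not_mem_AC0_of_parityReach` (decomp-pnenp cell, 2026-08-30).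
[cite: Smolensky1987] -/
theorem parityReachGivesMCSPNotAC0_proof :
    Summit.PneNP.PneNP.Theses.RootDecompMcspReach.ParityReachGivesMCSPNotAC0 := by
  unfold Summit.PneNP.PneNP.Theses.RootDecompMcspReach.ParityReachGivesMCSPNotAC0
  intro h hM
  -- `PARITY ∉ AC⁰`: from `AC⁰ ⊆ AC⁰[3]` and the tree's Smolensky theorem (the route's own import)
  have hPar : PARITY ∉ AC0 := fun hP =>
    Smolensky1987_modq_not_mem_AC0Mod_holds.parity_not_mem Nat.prime_three (by decide)
      (AC0_subset_AC0Mod 3 hP)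
  exact hPar (RootDecompMcspReachPort.mem_cdp_of_cdRed (B := acBasis) h hM)

end Summit.PneNP.PneNP.Theorems
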